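import Summits.QuantumFields.YangMills.Theorems.UnitScaleTiltProp7CovariantLocalMinimality
import HarnessLib

/-!
# Route `UnitScaleTilt`, crux K1 child «MinimiserStabilityRegPr» (stmt-QuantumFields-19200), registered stub `stub_prop7From14` (skeleton birth_v7
# cc37a178…; leaf V3 «Prop 7 from a background (14)») — QUADRATIC GROWTH OF THE WILSON ACTION OFF A SMALL-FIELD BACKGROUND FROM AN ℓ² POINCARÉ INEQUALITY
# OF THE REPRESENTATIVE (no gauge condition): the assembly step S5 of the blended-comb-gauge line, with the Poincaré inequality DISPLAYED as a hypothesis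

Cell `ym3-torus` ∕ fleet seat `ym-ust-19200-p1` (gen 9; HUMAN RULING D-0037, YM ladder rung R3).  WHY.  gen 2's non-flat local-minimality model
(`Prop7CovariantCoercivity.wilsonAction4_sub_background_ge_T3`) sums the per-plaquette Taylor expansion with the curl factor
(`quarter_hs_plaq_expansion_ge`: remainder `(2a² + 128δ² + 8a)·Σ_{b∈∂p}‖Y_b‖²`, so a sup bound `δ = O(η)` suffices) and then invokes [B9] Thm 3.11 in L² form
on the COVARIANT LANDAU SLICE of the MODEL averaging fibre.  The blended comb gauge of gen 9 (`Prop7BlendedGauge.exists_blendedGauge_T3`: a (4)-representative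
on the TRUE fibre with `‖Y_b‖ ≤ 551088(ε₀+e₀)η` on every bond) is not Landau; what the `ℓ²` route needs from it instead is an ℓ² POINCARÉ inequality
`Σ_b‖Y_b‖² ≤ C_P·η⁻²·Σ_p|C_p(Y)|²_HS` for the covariant curl form (CARD-19200-V3-g9 §3, stub S2).  This file is the assembly with that inequality as a
displayed hypothesis: Taylor summed + incidence + Poincaré ⟹ `(1/(16C_P))η²·Σ‖Y‖² − 12(2a²+128δ²+8a)Σ‖Y‖² ≤ A(U) − A(U₀) − Lin_{U₀}(Y)`, for ANY
representative — so that clause 1 of the stub follows from S2 (Poincaré for the blend), S4 (the first variation `Lin` along the fibre) and gen 6's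
`clause1_of_reprGrowth`.

WHAT IS PROVED (sorry-free, no definition).  **`growth_of_poincare_T3`**.

HONEST SCOPE.  Bookkeeping over gen 2's landed expansion; the Poincaré inequality and the first-variation bound are HYPOTHESES here (stubs S2, S4 of the line);
count-neutral helper toward stmt-QuantumFields-19200 (`--supports`).

References: T. Bałaban, CMP 102 (1985) 277–309 [Balaban1985Variational] ((26)–(31) pp.282–283, (141)–(143) p.299).
-/

noncomputable section

open scoped BigOperators Matrix.Norms.L2Operator Matrix

namespace Summit.QuantumFields.YangMills.Theorems.Prop7BlendGrowth

open Literature.MathematicalPhysics.QuantumFieldTheory.Balaban1983to89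
open Finset
open Summit.QuantumFields.YangMills.Theorems.Prop7CovariantCoercivity (quarter_hs_plaq_expansion_ge wilsonAction4_eq_quarter_sum_hs)
open Summit.QuantumFields.YangMills.Theorems.Prop7FlatLocalMin (sum_plaq_bonds_le)

/-- **QUADRATIC GROWTH OFF A SMALL-FIELD BACKGROUND FROM AN ℓ² POINCARÉ INEQUALITY OF THE REPRESENTATIVE** (d = 3 carrier; no gauge condition, no
averaging condition).  Background `U₀` with plaquette variables within `a = εL^{−2(K−n)}` of `1`; competitor `U` with `Y_b = U_bU₀,b* − 1`, `‖Y_b‖ ≤ δ ≤ 1`;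
POINCARÉ: `Σ_b‖Y_b‖² ≤ C_P·L^{2(K−n)}·Σ_p|C_p(Y)|²_HS` (`C_p(Y)` the transported linear part of `U(∂p)U₀(∂p)* − 1`, Hilbert–Schmidt).  Then
`((1/(16C_P))·L^{−2(K−n)} − 12(2a² + 128δ² + 8a))·Σ_b‖Y_b‖² ≤ A(U) − A(U₀) − Lin_{U₀}(Y)` with gen 2's exact first-order term `Lin`.
[cite: Balaban1985Variational, (26)-(31) pp.282-283, (141)-(143) p.299] -/
theorem growth_of_poincare_T3 (F : T3ContinuumYM3Torus.T3Family) (n K : ℕ)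
    (U U₀ : GaugeField (F.P K) 0 (Matrix.specialUnitaryGroup (Fin 2) ℂ)) {ε δ CP : ℝ} (hε : 0 ≤ ε) (hCP : 0 < CP)
    (hU₀ : ∀ p : Plaq (F.P K) 0, dist1 (GaugeField.plaqHol U₀ p) ≤ ε * (((F.L : ℝ) ^ (K - n)) ^ 2)⁻¹)
    (hδ : ∀ b : PBond (F.P K) 0, ‖(U b : Matrix (Fin 2) (Fin 2) ℂ) * star (U₀ b : Matrix (Fin 2) (Fin 2) ℂ) - 1‖ ≤ δ) (hδ1 : δ ≤ 1)
    (hP : ∑ b : PBond (F.P K) 0, ‖(U b : Matrix (Fin 2) (Fin 2) ℂ) * star (U₀ b : Matrix (Fin 2) (Fin 2) ℂ) - 1‖ ^ 2 ≤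
      CP * ((F.L : ℝ) ^ (K - n)) ^ 2 * ∑ p : Plaq (F.P K) 0, ∑ i₁ : Fin 2, ∑ i₂ : Fin 2,
          ‖(((U ⟨p.src, p.μ⟩ : Matrix (Fin 2) (Fin 2) ℂ) * star (U₀ ⟨p.src, p.μ⟩ : Matrix (Fin 2) (Fin 2) ℂ) - 1)
              + (U₀ ⟨p.src, p.μ⟩ : Matrix (Fin 2) (Fin 2) ℂ)
                  * ((U ⟨p.src.shift p.μ, p.ν⟩ : Matrix (Fin 2) (Fin 2) ℂ) * star (U₀ ⟨p.src.shift p.μ, p.ν⟩ : Matrix (Fin 2) (Fin 2) ℂ) - 1)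
                  * star (U₀ ⟨p.src, p.μ⟩ : Matrix (Fin 2) (Fin 2) ℂ)
              - (U₀ ⟨p.src, p.ν⟩ : Matrix (Fin 2) (Fin 2) ℂ)
                  * ((U ⟨p.src.shift p.ν, p.μ⟩ : Matrix (Fin 2) (Fin 2) ℂ) * star (U₀ ⟨p.src.shift p.ν, p.μ⟩ : Matrix (Fin 2) (Fin 2) ℂ) - 1)
                  * star (U₀ ⟨p.src, p.ν⟩ : Matrix (Fin 2) (Fin 2) ℂ)
              - ((U ⟨p.src, p.ν⟩ : Matrix (Fin 2) (Fin 2) ℂ) * star (U₀ ⟨p.src, p.ν⟩ : Matrix (Fin 2) (Fin 2) ℂ) - 1)) i₁ i₂‖ ^ 2) :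
    ((1 / (16 * CP)) * (((F.L : ℝ) ^ (K - n)) ^ 2)⁻¹
        - 12 * (2 * (ε * (((F.L : ℝ) ^ (K - n)) ^ 2)⁻¹) ^ 2 + 128 * δ ^ 2 + 8 * (ε * (((F.L : ℝ) ^ (K - n)) ^ 2)⁻¹)))
        * ∑ b : PBond (F.P K) 0, ‖(U b : Matrix (Fin 2) (Fin 2) ℂ) * star (U₀ b : Matrix (Fin 2) (Fin 2) ℂ) - 1‖ ^ 2
      ≤ wilsonAction4 U - wilsonAction4 U₀
        - ∑ p : Plaq (F.P K) 0, (1 / 2) * ((((((GaugeField.plaqHol U₀ p : Matrix.specialUnitaryGroup (Fin 2) ℂ) : Matrix (Fin 2) (Fin 2) ℂ)) - 1)ᴴ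
          * ((((U ⟨p.src, p.μ⟩ : Matrix (Fin 2) (Fin 2) ℂ) * star (U₀ ⟨p.src, p.μ⟩ : Matrix (Fin 2) (Fin 2) ℂ) - 1)
              + (U₀ ⟨p.src, p.μ⟩ : Matrix (Fin 2) (Fin 2) ℂ)
                  * ((U ⟨p.src.shift p.μ, p.ν⟩ : Matrix (Fin 2) (Fin 2) ℂ) * star (U₀ ⟨p.src.shift p.μ, p.ν⟩ : Matrix (Fin 2) (Fin 2) ℂ) - 1)
                  * star (U₀ ⟨p.src, p.μ⟩ : Matrix (Fin 2) (Fin 2) ℂ)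
              - ((U₀ ⟨p.src, p.μ⟩ * U₀ ⟨p.src.shift p.μ, p.ν⟩ * (U₀ ⟨p.src.shift p.ν, p.μ⟩)⁻¹ : Matrix.specialUnitaryGroup (Fin 2) ℂ) : Matrix (Fin 2) (Fin 2) ℂ)
                  * ((U ⟨p.src.shift p.ν, p.μ⟩ : Matrix (Fin 2) (Fin 2) ℂ) * star (U₀ ⟨p.src.shift p.ν, p.μ⟩ : Matrix (Fin 2) (Fin 2) ℂ) - 1)
                  * star ((U₀ ⟨p.src, p.μ⟩ * U₀ ⟨p.src.shift p.μ, p.ν⟩ * (U₀ ⟨p.src.shift p.ν, p.μ⟩)⁻¹ : Matrix.specialUnitaryGroup (Fin 2) ℂ) : Matrix (Fin 2) (Fin 2) ℂ)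
              - ((GaugeField.plaqHol U₀ p : Matrix.specialUnitaryGroup (Fin 2) ℂ) : Matrix (Fin 2) (Fin 2) ℂ)
                  * ((U ⟨p.src, p.ν⟩ : Matrix (Fin 2) (Fin 2) ℂ) * star (U₀ ⟨p.src, p.ν⟩ : Matrix (Fin 2) (Fin 2) ℂ) - 1)
                  * star ((GaugeField.plaqHol U₀ p : Matrix.specialUnitaryGroup (Fin 2) ℂ) : Matrix (Fin 2) (Fin 2) ℂ))
            * ((GaugeField.plaqHol U₀ p : Matrix.specialUnitaryGroup (Fin 2) ℂ) : Matrix (Fin 2) (Fin 2) ℂ))).trace).re := by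
  set Y : PBond (F.P K) 0 → Matrix (Fin 2) (Fin 2) ℂ := fun b => (U b : Matrix (Fin 2) (Fin 2) ℂ) * star (U₀ b : Matrix (Fin 2) (Fin 2) ℂ) - 1 with hY
  set a : ℝ := ε * (((F.L : ℝ) ^ (K - n)) ^ 2)⁻¹ with ha_def
  have hL0 : (0 : ℝ) < ((F.L : ℝ) ^ (K - n)) ^ 2 := by
    have : (0 : ℝ) < F.L := by have := F.hL.2; exact_mod_cast (by omega : 0 < F.L)
    positivity
  have ha : 0 ≤ a := mul_nonneg hε (inv_pos.mpr hL0).le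
  -- (1) the per-plaquette expansion, summed
  have hper := fun p : Plaq (F.P K) 0 => quarter_hs_plaq_expansion_ge U U₀ p ha (hU₀ p) hδ hδ1
  have hsum := Finset.sum_le_sum fun p (_ : p ∈ (Finset.univ : Finset (Plaq (F.P K) 0))) => hper p
  rw [← wilsonAction4_eq_quarter_sum_hs U] at hsum
  simp only [Finset.sum_sub_distrib, Finset.sum_add_distrib, ← Finset.mul_sum] at hsum
  have hA0 : (1 / 4 : ℝ) * ∑ p : Plaq (F.P K) 0, ∑ i₁ : Fin 2, ∑ i₂ : Fin 2,
      ‖((((GaugeField.plaqHol U₀ p : Matrix.specialUnitaryGroup (Fin 2) ℂ) : Matrix (Fin 2) (Fin 2) ℂ)) - 1) i₁ i₂‖ ^ 2 = wilsonAction4 U₀ := by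
    rw [wilsonAction4_eq_quarter_sum_hs, Finset.mul_sum]
  rw [hA0] at hsum
  -- (2) the Poincaré hypothesis in the form `(1/(16 C_P))·η²·Σ‖Y‖² ≤ (1/16)·Σ|curl|²`
  have hP' : (1 / (16 * CP)) * (((F.L : ℝ) ^ (K - n)) ^ 2)⁻¹ * ∑ b : PBond (F.P K) 0, ‖Y b‖ ^ 2 ≤
      (1 / 16) * ∑ p : Plaq (F.P K) 0, ∑ i₁ : Fin 2, ∑ i₂ : Fin 2,
          ‖(((U ⟨p.src, p.μ⟩ : Matrix (Fin 2) (Fin 2) ℂ) * star (U₀ ⟨p.src, p.μ⟩ : Matrix (Fin 2) (Fin 2) ℂ) - 1)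
              + (U₀ ⟨p.src, p.μ⟩ : Matrix (Fin 2) (Fin 2) ℂ)
                  * ((U ⟨p.src.shift p.μ, p.ν⟩ : Matrix (Fin 2) (Fin 2) ℂ) * star (U₀ ⟨p.src.shift p.μ, p.ν⟩ : Matrix (Fin 2) (Fin 2) ℂ) - 1)
                  * star (U₀ ⟨p.src, p.μ⟩ : Matrix (Fin 2) (Fin 2) ℂ)
              - (U₀ ⟨p.src, p.ν⟩ : Matrix (Fin 2) (Fin 2) ℂ)
                  * ((U ⟨p.src.shift p.ν, p.μ⟩ : Matrix (Fin 2) (Fin 2) ℂ) * star (U₀ ⟨p.src.shift p.ν, p.μ⟩ : Matrix (Fin 2) (Fin 2) ℂ) - 1)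
                  * star (U₀ ⟨p.src, p.ν⟩ : Matrix (Fin 2) (Fin 2) ℂ)
              - ((U ⟨p.src, p.ν⟩ : Matrix (Fin 2) (Fin 2) ℂ) * star (U₀ ⟨p.src, p.ν⟩ : Matrix (Fin 2) (Fin 2) ℂ) - 1)) i₁ i₂‖ ^ 2 := by
    have e : ∀ S : ℝ, (1 / (16 * CP)) * (((F.L : ℝ) ^ (K - n)) ^ 2)⁻¹ * (CP * ((F.L : ℝ) ^ (K - n)) ^ 2 * S) = (1 / 16) * S := by
      intro S
      have hLk : (0 : ℝ) < (F.L : ℝ) ^ (K - n) := by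
        have : (0 : ℝ) < F.L := by have := F.hL.2; exact_mod_cast (by omega : 0 < F.L)
        positivity
      field_simp
    have key := mul_le_mul_of_nonneg_left hP (show (0 : ℝ) ≤ (1 / (16 * CP)) * (((F.L : ℝ) ^ (K - n)) ^ 2)⁻¹ by positivity)
    rw [e] at key
    exact key
  -- (3) the error terms through the bond–plaquette incidence
  have hinc := sum_plaq_bonds_le (P := F.P K) (j := 0) (fun b => ‖Y b‖ ^ 2) (fun b => sq_nonneg _)
  have hd : ((F.P K).d : ℝ) = 3 := by norm_num [T3ContinuumYM3Torus.T3Family.P_d]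
  rw [hd] at hinc
  have hc0 : 0 ≤ 2 * a ^ 2 + 128 * δ ^ 2 + 8 * a := by positivity
  have herr := mul_le_mul_of_nonneg_left hinc hc0
  simp only [Finset.sum_add_distrib] at herr
  -- assemble
  simp only [hY] at hP' herr hsum
  rw [← Finset.mul_sum, sub_mul]
  linarith [hsum, hP', herr]

end Summit.QuantumFields.YangMills.Theorems.Prop7BlendGrowth

end
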